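import Summits.RiemannHypothesis.RiemannHypothesis.Theorems.ThetaTier2RowEval
import HarnessLib

/-!
# THETA tier-2 kernel checker — the ROW CHECK and its soundness: `Row2.check r = true → T2Valid r.inp r.real` (cc-s2-1; RH-FREE)

§6(e) of HOME/cc-s2-1/gen22/TIER2-KERNEL-SPEC.md, part 3 of 3.  `Row2.check` = rational side conditions ∧ the thirty atoms enclose ∧ the
thirteen composite `RExpr` fields enclose ∧ interval side conditions (`π`-width, window `e^{2δ}q < q⁺`, `e^{2δ} < 2`, `log N ≥ 2`) ∧
`certifyT2 (mkInp r X)`.  Soundness (atom table, closed forms and rounding lemmas: `ThetaTier2RowEval`):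
**`atomsOK : … → AtomsOK (r.mkInp X) r.real`**, and **`check_sound`**, which hands the E-side
`T2Valid r.inp r.real` (ThetaTier2Sound) together with the row facts `RowFacts r`.  Kernel cost MEASURED (farm, row `q = 461`): ≈ 14 s per row
(`decide +kernel`), of which ≈ 12 s is `stage1`.  Nothing here bears on the truth of RH.
-/

set_option linter.dupNamespace false  -- the mandated namespace repeats `RiemannHypothesis`
set_option autoImplicit false

namespace Summit.RiemannHypothesis.RiemannHypothesis.Theorems.ThetaTier2

open Literature.Analysis.ValidatedNumerics
open ThetaTier1 (Atom IH Rtop zetaHi pLamHi GAMMA_LO PREC HERON rpow eval_rpow enclList xOf valOf mem_xOf_of_enclList)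
open Real

namespace Row2

variable (r : Row2)

/-! ## The check -/

/-- The atom box of the row (junk if an atom fails to enclose). [this cell] -/
def box : ℕ → NonemptyInterval ℚ :=
  match enclList r.atoms with
  | some Is => xOf Is
  | none => fun _ => NonemptyInterval.pure 0

/-- **The kernel input of the row.** [this cell, TIER2-KERNEL-SPEC §1] -/
def inp : Inp := r.mkInp r.box

/-- All composite fields enclose. [this cell] -/
def encAll (X : ℕ → NonemptyInterval ℚ) : Bool := r.exprs.all fun e => (enc e X).isSome

/-- Rational side conditions (seed geometry, signs of the exact data). [this cell, TIER2-KERNEL-SPEC §4] -/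
def sideQ : Bool :=
  decide (r.q < r.qn) && decide (2 ≤ r.q) && decide (3 ≤ r.m) && decide (0 < r.delta) &&
  decide (r.eps < (r.m0 - r.c1) / 4) && decide (r.eps < (r.c2 - r.m0) / 4) &&
  decide (0 ≤ r.resid1) && decide (0 ≤ r.resid0) && decide (0 ≤ r.chiL) && decide (0 ≤ r.csum) &&
  ((List.range r.ncut).all fun j => decide (0 ≤ r.cutVal j) && decide (0 ≤ r.cutDerVal j)) &&
  ((List.range JG).all fun j => decide (0 ≤ r.gainA j) && decide (0 ≤ r.gainB j))

/-- Interval side conditions: `π` enclosed to width `2⁻³¹` with a positive lower end, the window `e^{2δ}q < q⁺`, `e^{2δ} < 2`,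
`log q + 2δ − 2η′ ≥ 2` (`log N ≥ 2` for the Chebyshev bound). [this cell, TIER2-KERNEL-SPEC §4] -/
def sideX (X : ℕ → NonemptyInterval ℚ) : Bool :=
  decide (0 ≤ (X 0).fst) && decide ((X 0).snd - (X 0).fst ≤ 1 / 2 ^ 31) &&
  decide ((X 27).snd * r.q < r.qn) && decide ((X 27).snd < 2) && decide (2 ≤ (X 28).fst + 2 * r.delta - 2 * r.eta)

/-- **The tier-2 row check** (what a data module decides with `decide +kernel`). [this cell, TIER2-KERNEL-SPEC §2] -/
def check : Bool :=
  r.sideQ &&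
  match enclList r.atoms with
  | none => false
  | some Is => r.encAll (xOf Is) && r.sideX (xOf Is) && certifyT2 (r.mkInp (xOf Is))

/-- **What a certified row asserts besides `T2Valid`** (admissibility data for the E-side). [this cell, TIER2-KERNEL-SPEC §4] -/
structure RowFacts (r : Row2) : Prop where
  q_lt : r.q < r.qn
  two_le_q : 2 ≤ r.q
  three_le_m : 3 ≤ r.m
  delta_pos : 0 < r.delta
  eps_lt₁ : r.eps < (r.m0 - r.c1) / 4
  eps_lt₂ : r.eps < (r.c2 - r.m0) / 4
  window : Real.exp ((2 * r.delta : ℚ) : ℝ) * r.q < r.qn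
  exp_lt_two : Real.exp ((2 * r.delta : ℚ) : ℝ) < 2
  logN : 2 ≤ Real.log r.q + ((2 * r.delta - 2 * r.eta : ℚ) : ℝ)

/-! ## The atoms enclose -/

/-- Positivity of `ζ*`. [this cell] -/
theorem zsR_pos (hq : 2 ≤ r.q) (hd : 0 < r.delta) : 0 < r.zsR := by
  unfold zsR
  have : (0 : ℝ) < r.q := by exact_mod_cast (by omega : 0 < r.q)
  have : (0 : ℝ) < r.delta := by exact_mod_cast hd
  positivity

/-- `zetaHi ≥ 0`. [this cell] -/
theorem zetaHi_nonneg (m : ℕ) : (0 : ℝ) ≤ (zetaHi m : ℝ) := by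
  have : (0 : ℚ) ≤ zetaHi m := by unfold ThetaTier1.zetaHi; split_ifs <;> norm_num
  exact_mod_cast this

/-- **The kernel input encloses the row's real data.** [this cell, TIER2-KERNEL-SPEC §1] -/
theorem atomsOK {Is : List (NonemptyInterval ℚ)} (hIs : enclList r.atoms = some Is) (hQ : r.sideQ = true)
    (hE : r.encAll (xOf Is) = true) (hXs : r.sideX (xOf Is) = true) : AtomsOK (r.mkInp (xOf Is)) r.real := by
  set X := xOf Is with hXdef
  have hx : ∀ i, r.vals i ∈ (X i).ratCast ℝ := mem_xOf_of_enclList hIs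
  -- rational side conditions
  unfold sideQ at hQ
  simp only [Bool.and_eq_true, decide_eq_true_eq, List.all_eq_true, List.mem_range] at hQ
  obtain ⟨⟨⟨⟨⟨⟨⟨⟨⟨⟨⟨hqlt, hq2⟩, hm3⟩, hd⟩, he1⟩, he2⟩, hR1⟩, hR0⟩, hchi⟩, hcs⟩, hcut⟩, hgain⟩ := hQ
  -- interval side conditions
  unfold sideX at hXs
  simp only [Bool.and_eq_true, decide_eq_true_eq] at hXs
  obtain ⟨⟨⟨⟨hpi0, hpiw⟩, -⟩, -⟩, hlogN⟩ := hXs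
  -- the composite enclosures
  unfold encAll exprs at hE
  simp only [List.all_cons, List.all_nil, Bool.and_true, Bool.and_eq_true, Option.isSome_iff_exists] at hE
  obtain ⟨⟨I0, hI0⟩, ⟨I1, hI1⟩, ⟨I2, hI2⟩, ⟨I3, hI3⟩, ⟨I4, hI4⟩, ⟨I5, hI5⟩, ⟨I6, hI6⟩, ⟨I7, hI7⟩, ⟨I8, hI8⟩, ⟨I9, hI9⟩,
    ⟨I10, hI10⟩, ⟨I11, hI11⟩, ⟨I12, hI12⟩⟩ := hE
  have mem := fun (e : RExpr) {I : NonemptyInterval ℚ} (h : enc e X = some I) => RExpr.eval_mem_enclose hx e h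
  obtain ⟨v0, v1, v2, v3, v4, v5, v6, v7, v8, v9, v10, v11, v12, v13, v14, v15, v16, v17, v18, v19, v20, v21, v22, v23, v24, v25,
    v26, v27, v28, v29⟩ := r.vals_table
  have at_ : ∀ i, ((X i).fst : ℝ) ≤ r.vals i ∧ r.vals i ≤ (X i).snd := fun i => by
    have := hx i; rwa [NonemptyInterval.mem_ratCast_iff] at this
  -- positivity facts
  have hq0 : (0 : ℝ) < r.q := by exact_mod_cast (by omega : 0 < r.q)
  have hd0 : (0 : ℝ) < r.delta := by exact_mod_cast hd
  have hzs := r.zsR_pos hq2 hd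
  have hm0 : (0 : ℝ) < r.m := by exact_mod_cast (by omega : 0 < r.m)
  have hth0 : 0 < r.th0R := by unfold th0R; positivity
  have hrat : 0 ≤ r.ratMR := by unfold ratMR; positivity
  have hcs' : (0 : ℝ) ≤ r.csum := by exact_mod_cast hcs
  have hM0 : 0 ≤ r.M0R := by unfold M0R; positivity
  have hc2 : (0 : ℝ) ≤ r.c2 := by unfold c2; norm_num
  have heps : (0 : ℝ) ≤ r.eps := by exact_mod_cast (show (0 : ℚ) ≤ r.eps by unfold eps c2 delta; positivity)
  have hM10 : 0 ≤ r.M10R := by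
    unfold M10R
    have : (0 : ℝ) ≤ ((2 * r.q * r.csum / r.c2 : ℚ) : ℝ) := by
      exact_mod_cast (show (0 : ℚ) ≤ 2 * r.q * r.csum / r.c2 by unfold c2; positivity)
    positivity
  have hsq : 0 < Real.sqrt r.q := Real.sqrt_pos.2 hq0
  have hlog : 0 ≤ Real.log r.q := Real.log_nonneg (by exact_mod_cast (by omega : 1 ≤ r.q))
  have hhmax : (0 : ℝ) ≤ r.hmax := by exact_mod_cast (le_trans zero_le_one (le_max_left 1 r.alpha) : (0 : ℚ) ≤ r.hmax)
  refine
    { cell := ?_, τ_le := ?_, θ₀_lo := ?_, θ₀_hi := ?_, u₁_nonneg := ?_, u₁_le := ?_, Mb_nonneg := ?_, Mb_le := ?_,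
      Mb1_nonneg := ?_, Mb1_le := ?_, E1_nonneg := ?_, E1_le := ?_, E2_nonneg := ?_, E2_le := ?_, E3_nonneg := ?_, E3_le := ?_,
      e0_nonneg := ?_, e0_le := ?_, t0_nonneg := ?_, t0_le := ?_, cA_nonneg := ?_, cA_le := ?_, Λ_nonneg := ?_, Λ_le := ?_,
      C_nonneg := ?_, C_le := ?_, T_le := ?_, Gt_le := ?_, z_le := ?_, eml_nonneg := ?_, eml_le := ?_, χ_nonneg := ?_, χ_le := ?_,
      ra_nonneg := ?_, ra_le := ?_, rb_nonneg := ?_, rb_le := ?_, rc_le := ?_, L_ge := ?_, d_ge := ?_, Ra_ge := ?_, Rb_ge := ?_,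
      cb_mem := ?_, cpb_mem := ?_ }
  · -- CellAtoms
    refine
      { τ_pos := by show (0 : ℝ) < ((TAU : ℚ) : ℝ); unfold TAU; norm_num, θ₀_pos := hth0, etL := ?_, etH := ?_, emhStep := ?_,
        emStep := ?_, em1Step := ?_, ehStep := ?_, M₀_nonneg := hM0, M₀_le := ?_, M₁₀_nonneg := hM10, M₁₀_le := ?_,
        c₂_nonneg := hc2, c₂_le := le_val_upQ _, ε_nonneg := heps, ε_le := le_val_upQ _,
        R_nonneg := by show (0 : ℝ) ≤ (r.resid1 : ℝ); exact_mod_cast hR1, R_le := le_val_upQ _,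
        Rm_nonneg := by show (0 : ℝ) ≤ (r.resid0 : ℝ); exact_mod_cast hR0, Rm_le := le_val_upQ _,
        pi_mem := ?_, pi_width := ?_, m_pos := by show 1 ≤ r.m; omega }
    · show val (dnQ (X 12).fst) ≤ exp ((TAU : ℚ) : ℝ)
      exact val_dnQ_le_of_le (v12 ▸ (at_ 12).1) (exp_pos _).le
    · show exp ((TAU : ℚ) : ℝ) ≤ val (upQ (X 12).snd)
      exact (v12 ▸ (at_ 12).2).trans (le_val_upQ _)
    · show exp (-(r.m + 1 / 2 : ℝ) * ((TAU : ℚ) : ℝ)) ≤ val (upQ (X 13).snd)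
      have h := (at_ 13).2; rw [v13] at h; push_cast at h; exact h.trans (le_val_upQ _)
    · show exp (-(r.m : ℝ) * ((TAU : ℚ) : ℝ)) ≤ val (upQ (X 14).snd)
      have h := (at_ 14).2; rw [v14] at h; push_cast at h; exact h.trans (le_val_upQ _)
    · show exp (-(r.m - 1 : ℝ) * ((TAU : ℚ) : ℝ)) ≤ val (upQ (X 15).snd)
      have h := (at_ 15).2; rw [v15] at h; push_cast at h; exact h.trans (le_val_upQ _)
    · show exp (-(1 / 2 : ℝ) * ((TAU : ℚ) : ℝ)) ≤ val (upQ (X 16).snd)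
      have h := (at_ 16).2; rw [v16] at h; push_cast at h
      rw [show -(1 / 2 : ℝ) * ((TAU : ℚ) : ℝ) = -((TAU : ℚ) : ℝ) / 2 by ring]; exact h.trans (le_val_upQ _)
    · show r.M0R ≤ val (hiOf (enc r.eM0 X))
      exact le_val_hiOf hI1 (r.eval_eM0 ▸ mem r.eM0 hI1)
    · show r.M10R ≤ val (hiOf (enc r.eM10 X))
      exact le_val_hiOf hI4 (r.eval_eM10 ▸ mem r.eM10 hI4)
    · show val (dnQ (X 0).fst) ≤ π ∧ π ≤ val (upQ (X 0).snd)
      exact ⟨val_dnQ_le_of_le (v0 ▸ (at_ 0).1) pi_pos.le, (v0 ▸ (at_ 0).2).trans (le_val_upQ _)⟩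
    · show val (upQ (X 0).snd) - val (dnQ (X 0).fst) ≤ 1 / 2 ^ 30
      have h1 := val_upQ_le (X 0).snd (le_trans hpi0 (X 0).2)
      have h2 := le_val_dnQ (X 0).fst
      have h3 : (((X 0).snd : ℚ) : ℝ) - (X 0).fst ≤ 1 / 2 ^ 31 := by
        have h := (Rat.cast_le (K := ℝ)).2 hpiw
        push_cast at h; exact h
      have h4 : 1 / (S : ℝ) ≤ 1 / 2 ^ 33 := by rw [S_cast_eq]; norm_num
      linarith
  · show ((TAU : ℚ) : ℝ) ≤ val (upQ TAU); exact le_val_upQ _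
  · show val (loOf (enc r.eTh0 X)) ≤ r.th0R
    exact val_loOf_le hI0 (r.eval_eTh0 ▸ mem r.eTh0 hI0) hth0.le
  · show r.th0R ≤ val (hiOf (enc r.eTh0 X))
    exact le_val_hiOf hI0 (r.eval_eTh0 ▸ mem r.eTh0 hI0)
  · show 0 ≤ exp ((r.eta - r.delta : ℚ) : ℝ) * (Real.sqrt r.q)⁻¹; positivity
  · show exp ((r.eta - r.delta : ℚ) : ℝ) * (Real.sqrt r.q)⁻¹ ≤ val (hiOf (enc r.eU1 X))
    exact le_val_hiOf hI3 (r.eval_eU1 ▸ mem r.eU1 hI3)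
  · show 0 ≤ r.M0R * (zetaHi (r.m + 1) : ℝ); exact mul_nonneg hM0 (zetaHi_nonneg _)
  · show r.M0R * (zetaHi (r.m + 1) : ℝ) ≤ val (hiOf (enc r.eMbar X))
    exact le_val_hiOf hI2 (r.eval_eMbar ▸ mem r.eMbar hI2)
  · show 0 ≤ r.M10R * ((zetaHi r.m : ℝ) * ((r.c2 : ℝ) + (r.eps : ℝ) * (1 + r.th0R⁻¹)))
    have := zetaHi_nonneg r.m; positivity
  · show r.M10R * ((zetaHi r.m : ℝ) * ((r.c2 : ℝ) + (r.eps : ℝ) * (1 + r.th0R⁻¹))) ≤ val (hiOf (enc r.eMbar1 X))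
    exact le_val_hiOf hI5 (r.eval_eMbar1 ▸ mem r.eMbar1 hI5)
  · exact (exp_pos _).le
  · show exp _ ≤ val (upQ (X 17).snd); exact (v17 ▸ (at_ 17).2).trans (le_val_upQ _)
  · exact (exp_pos _).le
  · show exp _ ≤ val (upQ (X 18).snd); exact (v18 ▸ (at_ 18).2).trans (le_val_upQ _)
  · exact (exp_pos _).le
  · show exp _ ≤ val (upQ (X 19).snd); exact (v19 ▸ (at_ 19).2).trans (le_val_upQ _)
  · exact (exp_pos _).le
  · show exp _ ≤ val (upQ (X 23).snd); exact (v23 ▸ (at_ 23).2).trans (le_val_upQ _)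
  · show (0 : ℝ) ≤ (r.t0 : ℝ); unfold t0; positivity
  · exact le_val_upQ _
  · exact le_max_left _ _
  · show r.real.cA ≤ val (hiOf (enc r.eCoefA X))
    exact le_val_hiOf hI6 (r.eval_eCoefA ▸ mem r.eCoefA hI6)
  · show (0 : ℝ) ≤ (pLamHi (r.m + 1) : ℝ); unfold ThetaTier1.pLamHi; positivity
  · exact le_val_upQ _
  · show 0 ≤ 2 * Real.log 2 + 2 * (Real.log r.q + ((2 * r.delta - 2 * r.eta : ℚ) : ℝ)) * exp ((r.eta - r.delta : ℚ) : ℝ)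
      * (Real.sqrt r.q)⁻¹
    have hN : 0 ≤ Real.log r.q + ((2 * r.delta - 2 * r.eta : ℚ) : ℝ) := by
      have h := (at_ 28).1; rw [v28] at h
      have h' : (2 : ℝ) ≤ (((X 28).fst + 2 * r.delta - 2 * r.eta : ℚ) : ℝ) := by exact_mod_cast hlogN
      push_cast at h' ⊢; linarith
    have := Real.log_nonneg (by norm_num : (1 : ℝ) ≤ 2)
    positivity
  · exact le_val_hiOf hI9 (r.eval_eCpsi ▸ mem r.eCpsi hI9)
  · exact le_val_hiOf hI8 (r.eval_eTailInt ▸ mem r.eTailInt hI8)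
  · exact le_val_hiOf hI7 (r.eval_eGtail ▸ mem r.eGtail hI7)
  · exact le_val_upQ _
  · exact (exp_pos _).le
  · show exp _ ≤ val (upQ (X 26).snd); exact (v26 ▸ (at_ 26).2).trans (le_val_upQ _)
  · show (0 : ℝ) ≤ (r.chiL : ℝ); exact_mod_cast hchi
  · exact le_val_upQ _
  · show 0 ≤ ((4 * r.delta * r.hmax : ℚ) : ℝ) * exp ((r.delta : ℚ) : ℝ); push_cast; positivity
  · exact le_val_hiOf hI10 (r.eval_eRA ▸ mem r.eRA hI10)
  · show 0 ≤ ((2 * r.delta : ℚ) : ℝ) * exp ((r.delta : ℚ) : ℝ) * (Real.sqrt r.q)⁻¹; push_cast; positivity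
  · exact le_val_hiOf hI11 (r.eval_eRB ▸ mem r.eRB hI11)
  · exact le_val_hiOf hI12 (r.eval_eRcoef ▸ mem r.eRcoef hI12)
  · show val (dnQ (X 28).fst) ≤ Real.log r.q; exact val_dnQ_le_of_le (v28 ▸ (at_ 28).1) hlog
  · show val (dnQ (r.delta / JG)) ≤ ((r.delta / JG : ℚ) : ℝ)
    exact val_dnQ_le (div_nonneg hd.le (by unfold JG; norm_num))
  · intro j hj
    change j < ((List.range JG).map fun j => (dnQ (r.gainA j), dnQ (r.gainB j))).length at hj
    have hj' : j < JG := by simpa using hj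
    show val (((List.range JG).map fun j => (dnQ (r.gainA j), dnQ (r.gainB j))).getD j (0, 0)).1 ≤ (r.gainA j : ℝ)
    rw [getD_map_range _ _ _ _ hj']
    exact val_dnQ_le (hgain j hj').1
  · intro j hj
    change j < ((List.range JG).map fun j => (dnQ (r.gainA j), dnQ (r.gainB j))).length at hj
    have hj' : j < JG := by simpa using hj
    show val (((List.range JG).map fun j => (dnQ (r.gainA j), dnQ (r.gainB j))).getD j (0, 0)).2 ≤ (r.gainB j : ℝ)
    rw [getD_map_range _ _ _ _ hj']
    exact val_dnQ_le (hgain j hj').2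
  · intro i
    show 0 ≤ (if i < r.ncut then (r.cutVal i : ℝ) else 1) ∧
      (if i < r.ncut then (r.cutVal i : ℝ) else 1) ≤
        val (if i < r.ncut then ((List.range r.ncut).map fun j => upQ (r.cutVal j)).getD i S else S)
    by_cases hi : i < r.ncut
    · rw [if_pos hi, if_pos hi, getD_map_range _ _ _ _ hi]
      exact ⟨by exact_mod_cast (hcut i hi).1, le_val_upQ _⟩
    · rw [if_neg hi, if_neg hi, val_S]; exact ⟨zero_le_one, le_rfl⟩
  · intro i
    show 0 ≤ (if i < r.ncut then (r.cutDerVal i : ℝ) else 0) ∧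
      (if i < r.ncut then (r.cutDerVal i : ℝ) else 0) ≤
        val (if i < r.ncut then ((List.range r.ncut).map fun j => upQ (r.cutDerVal j)).getD i 0 else 0)
    by_cases hi : i < r.ncut
    · rw [if_pos hi, if_pos hi, getD_map_range _ _ _ _ hi]
      exact ⟨by exact_mod_cast (hcut i hi).2, le_val_upQ _⟩
    · rw [if_neg hi, if_neg hi, val_zero]; exact ⟨le_rfl, le_rfl⟩

/-- **Soundness of the tier-2 row check**: a passing row yields (K1)–(K7) for its real data, and the admissibility facts.
[this cell, TIER2-KERNEL-SPEC §0/§5; THETA-CERT-cc6 §E6] -/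
theorem check_sound (h : r.check = true) : T2Valid r.inp r.real ∧ RowFacts r := by
  unfold check at h
  simp only [Bool.and_eq_true] at h
  obtain ⟨hQ, hrest⟩ := h
  split at hrest
  · exact absurd hrest Bool.false_ne_true
  · rename_i Is hIs
    simp only [Bool.and_eq_true] at hrest
    obtain ⟨⟨hE, hXs⟩, hcert⟩ := hrest
    have hbox : r.box = xOf Is := by unfold box; rw [hIs]
    have hinp : r.inp = r.mkInp (xOf Is) := by unfold inp; rw [hbox]
    have hA := r.atomsOK hIs hQ hE hXs
    refine ⟨hinp ▸ certify_sound _ _ hA hcert, ?_⟩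
    -- the row facts
    have hx : ∀ i, r.vals i ∈ (xOf Is i).ratCast ℝ := mem_xOf_of_enclList hIs
    obtain ⟨-, -, -, -, -, -, -, -, -, -, -, -, -, -, -, -, -, -, -, -, -, -, -, -, -, -, -, v27, v28, -⟩ := r.vals_table
    have m27 := hx 27; have m28 := hx 28
    rw [NonemptyInterval.mem_ratCast_iff, v27] at m27
    rw [NonemptyInterval.mem_ratCast_iff, v28] at m28
    unfold sideQ at hQ
    simp only [Bool.and_eq_true, decide_eq_true_eq] at hQ
    obtain ⟨⟨⟨⟨⟨⟨⟨⟨⟨⟨⟨hqlt, hq2⟩, hm3⟩, hd⟩, he1⟩, he2⟩, -⟩, -⟩, -⟩, -⟩, -⟩, -⟩ := hQ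
    unfold sideX at hXs
    simp only [Bool.and_eq_true, decide_eq_true_eq] at hXs
    obtain ⟨⟨⟨⟨-, -⟩, hwin⟩, htwo⟩, hlogN⟩ := hXs
    have hq0 : (0 : ℝ) ≤ r.q := Nat.cast_nonneg _
    refine ⟨hqlt, hq2, hm3, hd, he1, he2, ?_, ?_, ?_⟩
    · calc exp ((2 * r.delta : ℚ) : ℝ) * r.q ≤ ((xOf Is 27).snd : ℝ) * r.q := mul_le_mul_of_nonneg_right m27.2 hq0
        _ = (((xOf Is 27).snd * r.q : ℚ) : ℝ) := by push_cast; ring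
        _ < r.qn := by exact_mod_cast hwin
    · exact m27.2.trans_lt (by exact_mod_cast htwo)
    · have h' : (2 : ℝ) ≤ (((xOf Is 28).fst + 2 * r.delta - 2 * r.eta : ℚ) : ℝ) := by exact_mod_cast hlogN
      push_cast at h' ⊢; linarith [m28.1]

end Row2

end Summit.RiemannHypothesis.RiemannHypothesis.Theorems.ThetaTier2
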